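import Mathlib
import Literature.NumberTheory.LFunctions.Zhang2022.Section11AFEObjects
import HarnessLib

/-!
# Zhang (2022) §11, proof of Lemma 11.2 for `χψ` — sub-step (g) of `Z22:§11.u024` PROVED:
# completing the dual head `n < P₁` to the full dual sum costs `O(exp{−𝓛¹⁰})`

Topic `Literature/NumberTheory/LFunctions/Zhang2022` (Landau–Siegel audit tree; verdict-neutral).
Y. Zhang, *Discrete mean estimates and the Landau–Siegel zero*, arXiv:2211.02515v1 (2022)
[Zhang2022LandauSiegel] — **an unrefereed manuscript under adjudication** (campaign D-0069; nothing
here bears on Theorems 1–2 or on Landau–Siegel zeros). Companion of `Section11AFEObjects`.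
PROVED: `dualTail11_holds : DualTail11` — for `D ≥ e⁵`, `σ = 1/2`, `0.5 ≤ z ≤ 0.504`,
`|Z(s,χψ)|·|Σ_{n≥P₁} χψ̄(n)n^{−(1−s)}g(P^{1−z}Dt₀/n)| ≤ e^{−𝓛¹⁰}`: `|Z(s,χψ)| = 1` on the critical
line (the tree's `Skeleton.norm_Zpc_eq_one`, `psiChiPrimitive_holds`), (4.3)
"`g(x) = O(exp{−𝓛³⁰log²x})` if `x ≤ 1`" (the tree's `GaussWeight.gWeight_le`) with
`log(n/Y) ≥ log(P₁/Y) ≥ 1`, `Y = P^{1−z}Dt₀`, so each term is `≤ ½e^{−𝓛¹⁰}n⁻²`.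

## References

* Y. Zhang, arXiv:2211.02515v1 (2022), §4 (4.3); §11 Lemma 11.2, p. 65.
  [cite: Zhang2022LandauSiegel, §4 (4.3); §11 Lemma 11.2]
-/

noncomputable section

open Complex Real ComplexConjugate MeasureTheory Set Filter Topology

namespace Literature.NumberTheory.LFunctions.Zhang2022.Section11AFE

open Skeleton GaussWeight Section6Statements

/-! ## §1. Block (g) PROVED: completing the dual head `n < P₁` to the full dual sum costs `O(ε)` -/

section BlockG

variable {D : ℕ} [NeZero D] (χ : DirichletCharacter ℂ D) (x : Chr D)

omit [NeZero D] in
/-- Parameter bookkeeping for (g): for `𝓛 ≥ 5` and `0.5 ≤ z ≤ 0.504`, with `Y = R/P^z = P^{1−z}Dt₀`: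
`log Y ≤ 𝓛⁹` and `log P₁ − log Y ≥ 1`. [cite: Zhang2022LandauSiegel, §2 (2.6), (2.8), (2.21)] -/
theorem log_dual_length_bounds (hL : 5 ≤ ell D) {z : ℝ} (hz1 : 0.5 ≤ z) (_hz2 : z ≤ 0.504) :
    0 < bigR D / bigP D ^ z ∧ Real.log (bigR D / bigP D ^ z) ≤ ell D ^ 9 ∧
      1 ≤ Real.log (Skeleton.P1 D) - Real.log (bigR D / bigP D ^ z) := by
  set L := ell D with hLdef
  have hL1 : 1 ≤ L := by linarith
  have hL0 : 0 < L := by linarith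
  have hP : 0 < bigP D := Real.exp_pos _
  have hlogP : Real.log (bigP D) = L ^ 9 := by rw [bigP, Real.log_exp]
  have hlogD : Real.log (D : ℝ) = L := by rw [hLdef, ell]
  have hD1 : (1 : ℝ) < D := by
    by_contra hle
    have := Real.log_nonpos (Nat.cast_nonneg D) (not_lt.mp hle)
    linarith
  have hD0 : (0 : ℝ) < D := by linarith
  have ht0 : t0 D = L ^ 519 := rfl
  have ht0pos : 0 < t0 D := by rw [ht0]; positivity
  have hY : bigR D / bigP D ^ z = bigP D ^ (1 - z) * (D : ℝ) * t0 D := bigR_div_rpow D z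
  have hYpos : 0 < bigR D / bigP D ^ z := by
    rw [hY]; exact mul_pos (mul_pos (Real.rpow_pos_of_pos hP _) hD0) ht0pos
  have hlogY : Real.log (bigR D / bigP D ^ z) = (1 - z) * L ^ 9 + L + 519 * Real.log L := by
    rw [hY, Real.log_mul (mul_pos (Real.rpow_pos_of_pos hP _) hD0).ne' ht0pos.ne',
      Real.log_mul (Real.rpow_pos_of_pos hP _).ne' hD0.ne', Real.log_rpow hP, hlogP, ht0,
      Real.log_pow, hlogD]
    push_cast
    ring
  have hlogL : Real.log L ≤ L := (Real.log_le_sub_one_of_pos hL0).trans (by linarith)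
  have hL8 : (390625 : ℝ) ≤ L ^ 8 := by
    calc (390625 : ℝ) = 5 ^ 8 := by norm_num
      _ ≤ L ^ 8 := pow_le_pow_left₀ (by norm_num) hL 8
  have hL9 : 390625 * L ≤ L ^ 9 := by
    calc 390625 * L ≤ L ^ 8 * L := by nlinarith
      _ = L ^ 9 := by ring
  have hlogP1 : Real.log (Skeleton.P1 D) = 0.504 * L ^ 9 := by
    rw [Skeleton.P1, Real.log_rpow hP, hlogP]
  refine ⟨hYpos, ?_, ?_⟩
  · rw [hlogY]; nlinarith
  · rw [hlogP1, hlogY]; nlinarith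

omit [NeZero D] in
/-- **The dual terms beyond `P₁` are tiny**: for `𝓛 ≥ 5`, `σ = 1/2`, `0.5 ≤ z ≤ 0.504` and
`n ≥ P₁`, `|χψ̄(n)n^{−(1−s)}g(P^{1−z}Dt₀/n)| ≤ ½e^{−𝓛¹⁰}n⁻²` — (4.3) "`g(x) = O(exp{−𝓛³⁰log²x})`
if `x ≤ 1`" with `log(n/Y) ≥ log(P₁/Y) ≥ 1`. [cite: Zhang2022LandauSiegel, §4 (4.3)] -/
theorem norm_dual_term_le (hL : 5 ≤ ell D) {s : ℂ} (hs : s.re = 1 / 2) {z : ℝ} (hz1 : 0.5 ≤ z)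
    (hz2 : z ≤ 0.504) {n : ℕ} (hn : ⌈Skeleton.P1 D⌉₊ ≤ n) :
    ‖conj (pc χ x n) * (n : ℂ) ^ (-(1 - s)) * (gW D (bigR D / bigP D ^ z / n) : ℂ)‖ ≤
      (1 / 2) * Real.exp (-(ell D ^ 10)) * ((n : ℝ) ^ 2)⁻¹ := by
  obtain ⟨hYpos, hlogY, hμ⟩ := log_dual_length_bounds hL hz1 hz2
  set L := ell D with hLdef
  set Y := bigR D / bigP D ^ z with hYdef
  have hL1 : 1 ≤ L := by linarith
  have hΛ : 0 < L ^ 30 := by positivity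
  have hP : 0 < bigP D := Real.exp_pos _
  have hP1pos : 0 < Skeleton.P1 D := Real.rpow_pos_of_pos hP _
  have hP1n : Skeleton.P1 D ≤ n := le_trans (Nat.le_ceil _) (by exact_mod_cast hn)
  have hnpos : 0 < (n : ℝ) := lt_of_lt_of_le hP1pos hP1n
  have hn0 : 0 < n := by exact_mod_cast hnpos
  -- the three factors
  have f1 : ‖conj (pc χ x n)‖ ≤ 1 := by
    rw [Complex.norm_conj, pc, norm_mul]
    exact mul_le_one₀ (x.ψ.norm_le_one _) (norm_nonneg _) (χ.norm_le_one _)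
  have f2 : ‖(n : ℂ) ^ (-(1 - s))‖ = Real.exp (-(1 / 2) * Real.log n) := by
    rw [Complex.norm_natCast_cpow_of_pos hn0, Real.rpow_def_of_pos hnpos]
    congr 1
    simp [hs]
    ring
  have hYn1 : Y / n ≤ 1 := by
    rw [div_le_one hnpos]
    have : Real.log Y ≤ Real.log n := by
      have h1 : Real.log Y ≤ Real.log (Skeleton.P1 D) := by linarith
      exact h1.trans (Real.log_le_log hP1pos hP1n)
    exact (Real.log_le_log_iff hYpos hnpos).mp this
  have hYn0 : 0 < Y / n := div_pos hYpos hnpos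
  have f3 : gW D (Y / n) ≤ (1 / 2) * Real.exp (-(L ^ 30) * (Real.log (Y / n)) ^ 2) := by
    rw [gW]; exact gWeight_le hΛ hYn0 hYn1
  have f3' : 0 ≤ gW D (Y / n) := by rw [gW]; exact (gWeight_pos hΛ _).le
  -- the exponent inequality
  set ρ := Real.log n - Real.log Y with hρ
  have hlogYn : Real.log (Y / n) = -ρ := by
    rw [Real.log_div hYpos.ne' hnpos.ne', hρ]; ring
  have hρ1 : 1 ≤ ρ := by
    have := Real.log_le_log hP1pos hP1n
    rw [hρ]; linarith
  have hmain : -(1 / 2) * Real.log n + -(L ^ 30) * ρ ^ 2 ≤ -(L ^ 10) + -(2 * Real.log n) := by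
    have hlogn : Real.log n = ρ + Real.log Y := by rw [hρ]; ring
    rw [hlogn]
    have h20 : (4 : ℝ) ≤ L ^ 20 :=
      le_trans (by norm_num : (4 : ℝ) ≤ 5 ^ 20) (pow_le_pow_left₀ (by norm_num) hL 20)
    have h9 : L ^ 9 ≤ L ^ 10 := by
      calc L ^ 9 = L ^ 9 * 1 := (mul_one _).symm
        _ ≤ L ^ 9 * L := by gcongr
        _ = L ^ 10 := by ring
    have hL10 : (1 : ℝ) ≤ L ^ 10 := one_le_pow₀ hL1
    have h30 : L ^ 10 * 4 ≤ L ^ 30 := by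
      calc L ^ 10 * 4 ≤ L ^ 10 * L ^ 20 := by gcongr
        _ = L ^ 30 := by ring
    have hρ0 : 0 ≤ ρ := by linarith
    have hρ2 : ρ ≤ ρ ^ 2 := by nlinarith
    have p1 : L ^ 30 * ρ ≤ L ^ 30 * ρ ^ 2 := mul_le_mul_of_nonneg_left hρ2 hΛ.le
    have p2 : L ^ 10 * 4 * ρ ≤ L ^ 30 * ρ := mul_le_mul_of_nonneg_right h30 hρ0
    have p3 : L ^ 10 ≤ L ^ 10 * ρ := le_mul_of_one_le_right (by positivity) hρ1
    have p5 : ρ ≤ L ^ 10 * ρ := le_mul_of_one_le_left hρ0 hL10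
    have hY' : Real.log Y ≤ L ^ 9 := hlogY
    linarith
  -- assemble
  have hn2 : ((n : ℝ) ^ 2)⁻¹ = Real.exp (-(2 * Real.log n)) := by
    rw [Real.exp_neg, show 2 * Real.log n = Real.log n + Real.log n by ring, Real.exp_add,
      Real.exp_log hnpos, pow_two]
  have hgnorm : ‖(gW D (Y / n) : ℂ)‖ = gW D (Y / n) := by
    rw [Complex.norm_real, Real.norm_eq_abs, abs_of_nonneg f3']
  calc ‖conj (pc χ x n) * (n : ℂ) ^ (-(1 - s)) * (gW D (Y / n) : ℂ)‖
      = ‖conj (pc χ x n)‖ * ‖(n : ℂ) ^ (-(1 - s))‖ * gW D (Y / n) := by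
        rw [norm_mul, norm_mul, hgnorm]
    _ ≤ 1 * Real.exp (-(1 / 2) * Real.log n) *
          ((1 / 2) * Real.exp (-(L ^ 30) * (Real.log (Y / n)) ^ 2)) := by
        rw [f2]
        gcongr
    _ = (1 / 2) * Real.exp (-(1 / 2) * Real.log n + -(L ^ 30) * ρ ^ 2) := by
        rw [hlogYn, neg_sq, Real.exp_add]; ring
    _ ≤ (1 / 2) * Real.exp (-(L ^ 10) + -(2 * Real.log n)) := by
        gcongr
    _ = (1 / 2) * Real.exp (-(ell D ^ 10)) * ((n : ℝ) ^ 2)⁻¹ := by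
        rw [Real.exp_add, hn2, hLdef]; ring

/-- **(g) PROVED**: the node `DualTail11` holds with `c = C = 1` for `D ≥ e⁵` — `|Z(s,χψ)| = 1` on
`σ = 1/2` (the tree's `Skeleton.norm_Zpc_eq_one`, `psiChiPrimitive_holds`) and
`Σ_{n≥P₁} ½e^{−𝓛¹⁰}n⁻² ≤ ½e^{−𝓛¹⁰}·π²/6 ≤ e^{−𝓛¹⁰}`. [cite: Zhang2022LandauSiegel, §4 (4.3); §11 p. 65] -/
theorem dualTail11_holds : DualTail11 := by
  refine ⟨1, one_pos, 1, ⌈Real.exp 5⌉₊, fun D _ χ hD _hq hp x s hs z hz1 hz2 => ?_⟩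
  obtain ⟨hre, him⟩ := hs
  -- `𝓛 ≥ 5`, `D ≥ 3`
  have hexp : Real.exp 5 ≤ D := le_trans (Nat.le_ceil _) (by exact_mod_cast hD)
  have hL : 5 ≤ ell D := (Real.le_log_iff_exp_le (lt_of_lt_of_le (Real.exp_pos _) hexp)).mpr hexp
  have hL1 : 1 ≤ ell D := by linarith
  have hD3 : 3 ≤ D := by
    have h3 : (3 : ℝ) ≤ Real.exp 5 := by
      have := Real.add_one_le_exp (5 : ℝ); linarith
    exact_mod_cast h3.trans hexp
  -- `|Z(s,χψ)| = 1`
  have hsim : 0 < s.im := by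
    have h1 := (abs_lt.mp him).1
    have h405 : ell D ^ 405 ≤ ell D ^ 519 := pow_le_pow_right₀ hL1 (by norm_num)
    rw [ell1] at h1; rw [t0] at h1
    nlinarith [Real.pi_gt_three, pow_nonneg (by linarith : (0:ℝ) ≤ ell D) 519]
  have hZ : ‖Zpc χ x s‖ = 1 := norm_Zpc_eq_one χ (psiChiPrimitive_holds D χ x hD3 hp) hre hsim
  -- the summand and its shift
  set Y := bigR D / bigP D ^ z with hYdef
  set Nn : ℕ := ⌈Skeleton.P1 D⌉₊ with hNn
  set f : ℕ → ℂ := fun n => conj (pc χ x n) * (n : ℂ) ^ (-(1 - s)) * (gW D (Y / n) : ℂ) with hf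
  have hP : 0 < bigP D := Real.exp_pos _
  have hNn1 : 1 ≤ Nn := Nat.one_le_iff_ne_zero.mpr (Nat.pos_iff_ne_zero.mp
    (Nat.ceil_pos.mpr (Real.rpow_pos_of_pos hP _)))
  have hpc0 : pc χ x 0 = 0 := by
    haveI : Fact (1 < D) := ⟨by omega⟩
    rw [pc, Nat.cast_zero, Nat.cast_zero, MulChar.map_nonunit χ not_isUnit_zero, mul_zero]
  have hf0 : f 0 = 0 := by simp [hf, hpc0]
  -- the bound `‖f (n + Nn)‖ ≤ ½e^{−𝓛¹⁰}/(n+1)²`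
  set A : ℝ := (1 / 2) * Real.exp (-(ell D ^ 10)) with hA
  have hA0 : 0 ≤ A := by positivity
  have hbound : ∀ n : ℕ, ‖f (n + Nn)‖ ≤ A * (1 / ((n : ℝ) + 1) ^ 2) := by
    intro n
    have hle : Nn ≤ n + Nn := Nat.le_add_left _ _
    have h := norm_dual_term_le χ x hL hre hz1 hz2 hle
    refine h.trans ?_
    rw [hA]
    have hn1 : ((n : ℝ) + 1) ^ 2 ≤ ((n + Nn : ℕ) : ℝ) ^ 2 := by
      have : (n : ℝ) + 1 ≤ ((n + Nn : ℕ) : ℝ) := by push_cast; exact_mod_cast (by omega : n + 1 ≤ n + Nn)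
      exact pow_le_pow_left₀ (by positivity) this 2
    have : (((n + Nn : ℕ) : ℝ) ^ 2)⁻¹ ≤ 1 / ((n : ℝ) + 1) ^ 2 := by
      rw [one_div]; exact inv_anti₀ (by positivity) hn1
    exact mul_le_mul_of_nonneg_left this (by positivity)
  -- summability
  have hzeta : HasSum (fun n : ℕ => (1 : ℝ) / ((n : ℝ) + 1) ^ 2) (π ^ 2 / 6) := by
    have h' := (hasSum_nat_add_iff' 1).mpr hasSum_zeta_two
    simp only [Finset.range_one, Finset.sum_singleton, Nat.cast_zero, ne_eq, OfNat.ofNat_ne_zero,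
      not_false_eq_true, zero_pow, div_zero, sub_zero, Nat.cast_add, Nat.cast_one] at h'
    exact h'
  have hsumg : Summable (fun n : ℕ => A * (1 / ((n : ℝ) + 1) ^ 2)) := hzeta.summable.mul_left A
  have hsf_shift : Summable (fun n : ℕ => ‖f (n + Nn)‖) :=
    Summable.of_nonneg_of_le (fun n => norm_nonneg _) hbound hsumg
  have hsf : Summable f := by
    have h1 : Summable (fun n : ℕ => f (n + Nn)) := hsf_shift.of_norm
    exact (summable_nat_add_iff Nn).mp h1
  -- `dualSum − dualHead = Σ_{n≥Nn} f`
  have hsplit : dualSum χ x Y s - dualHead χ x Y (Skeleton.P1 D) s = ∑' n : ℕ, f (n + Nn) := by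
    have h1 := hsf.sum_add_tsum_nat_add Nn
    have h01 : ∑ i ∈ Finset.Ico 0 1, f i = 0 := by
      rw [Finset.sum_Ico_eq_sum_range]; simp [hf0]
    have h2 : ∑ i ∈ Finset.range Nn, f i = dualHead χ x Y (Skeleton.P1 D) s := by
      rw [dualHead, Finset.range_eq_Ico, ← Finset.sum_Ico_consecutive f (Nat.zero_le 1) hNn1, h01,
        zero_add]
    rw [dualSum, ← h1, h2]
    ring
  -- conclude
  rw [norm_mul, hZ, one_mul, hsplit]
  calc ‖∑' n : ℕ, f (n + Nn)‖ ≤ ∑' n : ℕ, ‖f (n + Nn)‖ := norm_tsum_le_tsum_norm hsf_shift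
    _ ≤ ∑' n : ℕ, A * (1 / ((n : ℝ) + 1) ^ 2) := hsf_shift.tsum_le_tsum hbound hsumg
    _ = A * (π ^ 2 / 6) := by rw [tsum_mul_left, hzeta.tsum_eq]
    _ ≤ 1 * Real.exp (-1 * ell D ^ 10) := by
        rw [hA, neg_one_mul, one_mul]
        have hπ : π ^ 2 / 6 ≤ 2 := by nlinarith [Real.pi_lt_d2, Real.pi_pos]
        nlinarith [Real.exp_pos (-(ell D ^ 10))]

/-- `DualTail11` — `_holds` alias of `dualTail11_holds` above under the fact's exact name (appended
2026-08-28, D-0026 bookkeeping: the proof term is the existing theorem of this file; no statement,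
definition or attribute is edited; no new named fact; the ledger's debt table listed the fact
unproved). [cite: Zhang2022LandauSiegel, §4 (4.3); §11 p. 65] -/
theorem _root_.Literature.NumberTheory.LFunctions.Zhang2022.Section11AFE.DualTail11_holds :
    DualTail11 :=
  _root_.Literature.NumberTheory.LFunctions.Zhang2022.Section11AFE.dualTail11_holds

end BlockG

end Literature.NumberTheory.LFunctions.Zhang2022.Section11AFE
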